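import Literature.AlgebraicGeometry.Resolution.QuadraticTransforms
import HarnessLib

/-!
# Crux `Steer` (stmt-16345), chain W4.1 — dictionary piece T2 `chart_step`, file 1/4: LIFTING ring maps
# to the chart `R[𝔪_R/x]` and to its local ring at the centre (universal property inside `K`)

OURS (campaign `res-hironaka`, rung L, slot W4.1; helper toward the registered stub `stub_core4Iso` of
reshape r8 of line `switching_dichotomy`, lead res-L0-w41-lead-1's `DICT-SIGS.lean` piece T2; replaces the
role of no printed item; NOT a statement of the manuscript under review; AI-produced). Theses-free (imports
`Literature` + Mathlib only; chain build rule).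

For a local subring `R ⊆ K` of a field, `x ∈ 𝔪_R` non-zero, and the chart ring
`blowupRing R x = R[𝔪_R/x] ⊆ K` (`QuadraticTransforms.lean`):

* `exists_pow_mul_eq_of_mem_blowupRing` — every `z ∈ R[𝔪_R/x]` has `z · x^N = a` with `a ∈ 𝔪_R^N`;
* `exists_ringHom_blowupRing` — **universal property of the chart**: a ring map `θ : R → T` into a DOMAIN
  with `θ x ≠ 0` dividing every `θ y`, `y ∈ 𝔪_R`, extends (uniquely, though we only need existence) to
  `Ψ : R[𝔪_R/x] → T`; `Ψ (y/x) · θ x = θ y` and more generally `Ψ z · (θ x)^N = θ a` when `z x^N = a`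
  (Görtz–Wedhorn, proof of Prop. 13.92: "`x/f ↦` the unique `c` with `φ(f) c = φ(x)`", here for the chart
  realised inside `K`, by direct division — no Rees algebra);
* `exists_ringHom_locAtCentre` — a ring map `Ψ : B → T` on a subring `B ⊆ O` sending the elements of
  value `1` to units extends to the local ring `locAtCentre B O = B_{𝔪_O ∩ B}` (`IsLocalization.lift` over
  the tree's `isLocalization_locAtCentre`), with the fraction formula `Φ(z) · Ψ s = Ψ y` for `z = y/s`.

Sources: U. Görtz, T. Wedhorn, *Algebraic Geometry I* (2nd ed. 2020), Prop. 13.92 and its proof (the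
`A`-algebra maps `A[I/f] → C`); The Stacks Project, Tag 0804. Folklore commutative algebra.
-/

-- layout-mandated namespace `Summit.<Summit>.<Problem>.…` with Summit = Problem (single-conjunct summit)
set_option linter.dupNamespace false

open IsLocalRing
open Literature.AlgebraicGeometry.Resolution

namespace Summit.ResolutionOfSingularities.ResolutionOfSingularities.Theorems.SwitchingDichotomy

namespace ChartStep

variable {K : Type*} [Field K]

/-! ## Denominators in the chart ring -/

/-- Every element `z` of `R[𝔪_R/x]` satisfies `z · x ^ N = a` for some `N` and some `a ∈ 𝔪_R ^ N`
(for `x ∈ 𝔪_R`). [cite: StacksProject, Tag 0804] -/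
theorem exists_pow_mul_eq_of_mem_blowupRing {R : Subring K} [IsLocalRing R] {x : K} (hxR : x ∈ R)
    (hx0 : x ≠ 0) (hxm : (⟨x, hxR⟩ : R) ∈ maximalIdeal R) {z : K} (hz : z ∈ blowupRing R x) :
    ∃ (N : ℕ) (a : R), a ∈ maximalIdeal R ^ N ∧ z * x ^ N = a := by
  induction hz using Subring.closure_induction with
  | mem z hz =>
    rcases hz with hz | ⟨y, hy, rfl⟩
    · exact ⟨0, ⟨z, hz⟩, by simp, by rw [pow_zero, mul_one]⟩
    · exact ⟨1, y, by simpa using hy, by rw [pow_one, div_mul_cancel₀ _ hx0]⟩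
  | zero => exact ⟨0, 0, by simp, by simp⟩
  | one => exact ⟨0, 1, by simp, by simp⟩
  | add z₁ z₂ _ _ h₁ h₂ =>
    obtain ⟨N, a, ha, hza⟩ := h₁
    obtain ⟨M, b, hb, hzb⟩ := h₂
    refine ⟨N + M, a * ⟨x, hxR⟩ ^ M + b * ⟨x, hxR⟩ ^ N, ?_, ?_⟩
    · refine Ideal.add_mem _ ?_ ?_
      · rw [pow_add]
        exact Ideal.mul_mem_mul ha (Ideal.pow_mem_pow hxm M)
      · rw [add_comm, pow_add]
        exact Ideal.mul_mem_mul hb (Ideal.pow_mem_pow hxm N)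
    · rw [Subring.coe_add, Subring.coe_mul, Subring.coe_mul, Subring.coe_pow, Subring.coe_pow, ← hza,
        ← hzb]
      ring
  | neg z _ h =>
    obtain ⟨N, a, ha, hza⟩ := h
    exact ⟨N, -a, (maximalIdeal R ^ N).neg_mem ha, by rw [Subring.coe_neg, ← hza]; ring⟩
  | mul z₁ z₂ _ _ h₁ h₂ =>
    obtain ⟨N, a, ha, hza⟩ := h₁
    obtain ⟨M, b, hb, hzb⟩ := h₂
    refine ⟨N + M, a * b, ?_, ?_⟩
    · rw [pow_add]; exact Ideal.mul_mem_mul ha hb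
    · rw [Subring.coe_mul, ← hza, ← hzb]; ring

/-! ## The universal property of the chart ring (target a domain) -/

section Lift

variable {R : Subring K} [IsLocalRing R] {x : K} (hxR : x ∈ R) (hx0 : x ≠ 0)
  (hxm : (⟨x, hxR⟩ : R) ∈ maximalIdeal R)
  {T : Type*} [CommRing T] (θ : R →+* T) (hθx : θ ⟨x, hxR⟩ ≠ 0)
  (hθ : ∀ y ∈ maximalIdeal R, θ ⟨x, hxR⟩ ∣ θ y)

include hθ in
/-- `θ(𝔪_R^N) ⊆ (θ x)^N`. [folklore] -/
theorem pow_dvd_apply_of_mem_pow {N : ℕ} {a : R} (ha : a ∈ maximalIdeal R ^ N) :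
    θ ⟨x, hxR⟩ ^ N ∣ θ a := by
  have hle : Ideal.map θ (maximalIdeal R) ≤ Ideal.span {θ ⟨x, hxR⟩} := by
    rw [Ideal.map_le_iff_le_comap]
    intro y hy
    rw [Ideal.mem_comap, Ideal.mem_span_singleton]
    exact hθ y hy
  have h : θ a ∈ Ideal.span {θ ⟨x, hxR⟩ ^ N} := by
    rw [← Ideal.span_singleton_pow]
    exact Ideal.pow_right_mono hle N (by rw [← Ideal.map_pow]; exact Ideal.mem_map_of_mem θ ha)
  exact Ideal.mem_span_singleton.mp h

include hx0 hxm hθx hθ in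
/-- **Universal property of the chart ring `R[𝔪_R/x] ⊆ K`** (target a domain): a ring map
`θ : R → T` with `θ x ≠ 0` dividing `θ y` for every `y ∈ 𝔪_R` extends to `Ψ : R[𝔪_R/x] → T`, and
`Ψ z · (θ x)^N = θ a` whenever `z · x^N = a ∈ R`. Construction: the graph
`z ↦ c :⇔ ∃ N a, z x^N = a ∧ θ a = (θ x)^N c` is total (denominators lemma + divisibility), functional
(cancel a power of `θ x ≠ 0`), additive and multiplicative. [cite: StacksProject, Tag 0804] -/
theorem exists_ringHom_blowupRing [IsDomain T] :
    ∃ Ψ : blowupRing R x →+* T, (∀ r : R, Ψ ⟨r, le_blowupRing R x r.2⟩ = θ r) ∧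
      ∀ (z : blowupRing R x) (N : ℕ) (a : R), (z : K) * x ^ N = a → θ a = θ ⟨x, hxR⟩ ^ N * Ψ z := by
  classical
  -- the graph of the lift
  let Rel : blowupRing R x → T → Prop := fun z c =>
    ∃ (N : ℕ) (a : R), (z : K) * x ^ N = a ∧ θ a = θ ⟨x, hxR⟩ ^ N * c
  have hex : ∀ z, ∃ c, Rel z c := fun z => by
    obtain ⟨N, a, ha, hza⟩ := exists_pow_mul_eq_of_mem_blowupRing hxR hx0 hxm z.2
    obtain ⟨c, hc⟩ := pow_dvd_apply_of_mem_pow hxR θ hθ ha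
    exact ⟨c, N, a, hza, hc⟩
  have huniq' : ∀ {z c c'}, Rel z c → Rel z c' → c = c' := by
    rintro z c c' ⟨N, a, hza, hc⟩ ⟨M, b, hzb, hc'⟩
    have hab : a * ⟨x, hxR⟩ ^ M = b * ⟨x, hxR⟩ ^ N := by
      apply Subtype.ext
      simp only [Subring.coe_mul, Subring.coe_pow]
      rw [← hza, ← hzb]; ring
    have h2 := congrArg θ hab
    rw [map_mul, map_mul, map_pow, map_pow, hc, hc'] at h2
    have hne : θ ⟨x, hxR⟩ ^ N * θ ⟨x, hxR⟩ ^ M ≠ 0 :=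
      mul_ne_zero (pow_ne_zero _ hθx) (pow_ne_zero _ hθx)
    have h3 : θ ⟨x, hxR⟩ ^ N * θ ⟨x, hxR⟩ ^ M * c = θ ⟨x, hxR⟩ ^ N * θ ⟨x, hxR⟩ ^ M * c' := by
      calc θ ⟨x, hxR⟩ ^ N * θ ⟨x, hxR⟩ ^ M * c = θ ⟨x, hxR⟩ ^ N * c * θ ⟨x, hxR⟩ ^ M := by ring
        _ = θ ⟨x, hxR⟩ ^ M * c' * θ ⟨x, hxR⟩ ^ N := h2
        _ = θ ⟨x, hxR⟩ ^ N * θ ⟨x, hxR⟩ ^ M * c' := by ring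
    exact mul_left_cancel₀ hne h3
  have hadd : ∀ {z₁ z₂ c₁ c₂}, Rel z₁ c₁ → Rel z₂ c₂ → Rel (z₁ + z₂) (c₁ + c₂) := by
    rintro z₁ z₂ c₁ c₂ ⟨N, a, hza, hc⟩ ⟨M, b, hzb, hc'⟩
    refine ⟨N + M, a * ⟨x, hxR⟩ ^ M + b * ⟨x, hxR⟩ ^ N, ?_, ?_⟩
    · rw [Subring.coe_add]
      simp only [Subring.coe_add, Subring.coe_mul, Subring.coe_pow]
      rw [← hza, ← hzb]; ring
    · rw [map_add, map_mul, map_mul, map_pow, map_pow, hc, hc']; ring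
  have hmul : ∀ {z₁ z₂ c₁ c₂}, Rel z₁ c₁ → Rel z₂ c₂ → Rel (z₁ * z₂) (c₁ * c₂) := by
    rintro z₁ z₂ c₁ c₂ ⟨N, a, hza, hc⟩ ⟨M, b, hzb, hc'⟩
    refine ⟨N + M, a * b, ?_, ?_⟩
    · rw [Subring.coe_mul, Subring.coe_mul, ← hza, ← hzb]; ring
    · rw [map_mul, hc, hc']; ring
  have hcoe : ∀ r : R, Rel ⟨r, le_blowupRing R x r.2⟩ (θ r) := fun r => ⟨0, r, by simp, by simp⟩
  choose Ψ₀ hΨ₀ using hex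
  have huniq : ∀ {z c}, Rel z c → Ψ₀ z = c := fun {z c} h => huniq' (hΨ₀ z) h
  let Ψ : blowupRing R x →+* T :=
    { toFun := Ψ₀
      map_one' := huniq ⟨0, 1, by simp, by simp⟩
      map_mul' := fun z₁ z₂ => huniq (hmul (hΨ₀ z₁) (hΨ₀ z₂))
      map_zero' := huniq ⟨0, 0, by simp, by simp⟩
      map_add' := fun z₁ z₂ => huniq (hadd (hΨ₀ z₁) (hΨ₀ z₂)) }
  refine ⟨Ψ, fun r => huniq (hcoe r), fun z N a hza => ?_⟩
  -- compare the chosen representation of `z` with the given one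
  obtain ⟨M, b, hzb, hc⟩ := hΨ₀ z
  have hab : a * ⟨x, hxR⟩ ^ M = b * ⟨x, hxR⟩ ^ N := by
    apply Subtype.ext
    simp only [Subring.coe_mul, Subring.coe_pow]
    rw [← hza, ← hzb]; ring
  have h2 := congrArg θ hab
  rw [map_mul, map_mul, map_pow, map_pow, hc] at h2
  have h3 : θ ⟨x, hxR⟩ ^ M * (θ a) = θ ⟨x, hxR⟩ ^ M * (θ ⟨x, hxR⟩ ^ N * Ψ₀ z) := by
    calc θ ⟨x, hxR⟩ ^ M * θ a = θ a * θ ⟨x, hxR⟩ ^ M := by ring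
      _ = θ ⟨x, hxR⟩ ^ M * Ψ₀ z * θ ⟨x, hxR⟩ ^ N := h2
      _ = θ ⟨x, hxR⟩ ^ M * (θ ⟨x, hxR⟩ ^ N * Ψ₀ z) := by ring
  exact mul_left_cancel₀ (pow_ne_zero _ hθx) h3

end Lift

/-! ## Lifting to the local ring at the centre -/

/-- A ring map on a subring `B ⊆ O` sending the elements of value `1` (the complement of the centre of
`O`) to units extends to `locAtCentre B O = B_{𝔪_O ∩ B}`; on a fraction `z = y / s` (`v s = 1`) the
extension satisfies `Φ z · Ψ s = Ψ y`. [cite: NovacoskiSpivakovsky2014, Def. 2.8] -/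
theorem exists_ringHom_locAtCentre {B : Subring K} {O : ValuationSubring K} (hB : B ≤ O.toSubring)
    {T : Type*} [CommRing T] (Ψ : B →+* T)
    (hΨ : ∀ b : B, O.valuation (b : K) = 1 → IsUnit (Ψ b)) :
    ∃ Φ : locAtCentre B O →+* T, (∀ b : B, Φ ⟨b, le_locAtCentre B O b.2⟩ = Ψ b) ∧
      ∀ (z : locAtCentre B O) (y s : B), O.valuation (s : K) = 1 → (z : K) * s = y → Φ z * Ψ s = Ψ y := by
  haveI := isLocalization_locAtCentre (B := B) (O := O) hB
  have hunits : ∀ s : (subringCentre B O hB).primeCompl, IsUnit (Ψ s) :=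
    fun s => hΨ s (valuation_eq_one_of_not_mem_subringCentre hB s.2)
  refine ⟨IsLocalization.lift (M := (subringCentre B O hB).primeCompl) hunits, fun b => ?_,
    fun z y s hs hzs => ?_⟩
  · exact IsLocalization.lift_eq (M := (subringCentre B O hB).primeCompl) hunits b
  · have hz : z * algebraMap B (locAtCentre B O) s = algebraMap B (locAtCentre B O) y :=
      Subtype.ext hzs
    have := congrArg (IsLocalization.lift (M := (subringCentre B O hB).primeCompl) hunits) hz
    rwa [map_mul, IsLocalization.lift_eq, IsLocalization.lift_eq] at this

end ChartStep

end Summit.ResolutionOfSingularities.ResolutionOfSingularities.Theorems.SwitchingDichotomy
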